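import Mathlib.RingTheory.Polynomial.Chebyshev
import Mathlib.Analysis.SpecialFunctions.Trigonometric.Chebyshev.RootsExtrema
import Literature.Probability.FitznerVanDerHofstad2017.NbwRemainderKernel
import HarnessLib

/-!
# Closed-form (Chebyshev-U) bound for the NBW polynomials and the certified 'rig' evaluation

Kernel facts (pure real analysis + the tree's `nbwJ` of `NbwRemainderKernel.lean`), supporting the
b2b-lace package's NBW-kernel remainder device (LEMMAS §20 N53/N68; num3-g6 `NBW-TWIN.md` §3
(L1)–(L3), where the same closed form certifies the numerical 'rig' column).  Nothing here is quoted
from or attributed to [NoBLE17]/[FvdH17]; the NBW law itself (`b̂_m(k) = P_m(2d D̂(k))`, N68b) is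
NOT asserted here — every statement is over an ARBITRARY solution `Q : ℕ → ℝ[X]` of the NBW
three-term recursion (`IsNbwPolySeq d Q`: `Q₀ = 1`, `Q₁ = X`, `Q₂ = X² - 2d`,
`Q_{m+3} = X·Q_{m+2} - (2d-1)·Q_{m+1}`), which the tree's NBW-polynomial definition instantiates by
its defining equations.

* (L1) `Q_m(A) = R_m(A) - R_{m-2}(A)` with `R_m(A) = q^{m/2} U_m(A / 2√q)`, `q = 2d - 1`,
  `U_m` = Chebyshev polynomials of the second kind (`nbwR_eq_chebyshev`, `IsNbwPolySeq.eval_add_two`);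
* (L2) bulk bound: `|A| ≤ 2√q → |Q_m(A)| ≤ q^{m/2}(m+1) + q^{(m-2)/2}(m-1)` (`abs_eval_le_nbwBulkBound`),
  from `|U_m(x)| ≤ m + 1` on `[-1,1]` (`abs_eval_U_le`);
* (L3) sign off the bulk: `2√q ≤ A → 0 ≤ Q_m(A)` and `Q_m(-A) = (-1)^m Q_m(A)`;
* consequence: for a composition `c` of EVEN total degree, `-Π_i B(c_i) ≤ (Π_i Q_{c_i})(A)` for ALL
  real `A` (`IsNbwPolySeq.neg_prod_bound_le_eval`), and hence, by `nbwJ_le_coeff_sum_add`, the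
  table-only bound `J_n(Π_i Q_{c_i}) ≤ Σ_j [Π_i Q_{c_i}]_j (2d)^j I_{n,j}(0) + 2 Π_i B(c_i) · I_{n,0}(0)`
  (`IsNbwPolySeq.nbwJ_prod_le`), and for the `e₁`-type kernel `(Π_i Q_{c_i})·X/(2d)` of an ODD
  composition the same with `2 Π_i B(c_i)·(√q/d)` (`IsNbwPolySeq.nbwJ_prod_e1_le`) — ONE lemma family
  instead of a per-kernel polynomial-inequality certificate.  (Odd total degree — the superseded v1
  kernel forms — goes through the reflection bound `nbwJ_le_of_abs_le` of `NbwRemainderKernel.lean`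
  and is not spelled out here.)
-/

noncomputable section

open Real Finset Polynomial Polynomial.Chebyshev

namespace Literature.Probability.FitznerVanDerHofstad2017

/-! ## Chebyshev polynomials of the second kind: the two elementary bounds -/

/-- `U_{m+1} = X·U_m + T_{m+1}` at natural indices. [folklore] -/
theorem U_natCast_succ (m : ℕ) :
    U ℝ ((m + 1 : ℕ) : ℤ) = X * U ℝ (m : ℤ) + T ℝ ((m + 1 : ℕ) : ℤ) := by
  have h := U_eq_X_mul_U_add_T ℝ (m : ℤ)
  push_cast
  exact h

/-- `U_{m+2} = 2X·U_{m+1} - U_m` at natural indices. [folklore] -/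
theorem U_natCast_add_two (m : ℕ) :
    U ℝ ((m + 2 : ℕ) : ℤ) = 2 * X * U ℝ ((m + 1 : ℕ) : ℤ) - U ℝ (m : ℤ) := by
  have h := U_add_two ℝ (m : ℤ)
  push_cast
  exact h

/-- `U_{m+2} = 2T_{m+2} + U_m` at natural indices. [folklore] -/
theorem U_natCast_add_two_T (m : ℕ) :
    U ℝ ((m + 2 : ℕ) : ℤ) = 2 * T ℝ ((m + 2 : ℕ) : ℤ) + U ℝ (m : ℤ) := by
  have h := U_eq_two_mul_T_add_U ℝ (m : ℤ)
  push_cast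
  exact h

/-- `|U_m(x)| ≤ m + 1` on `[-1,1]` (from `U_{m+1} = X·U_m + T_{m+1}` and `|T_n| ≤ 1`). [folklore] -/
theorem abs_eval_U_le (m : ℕ) {x : ℝ} (hx : |x| ≤ 1) : |(U ℝ (m : ℤ)).eval x| ≤ (m : ℝ) + 1 := by
  induction m with
  | zero => simp
  | succ m ih =>
    rw [U_natCast_succ, eval_add, eval_mul, eval_X]
    have hT := abs_eval_T_real_le_one ((m + 1 : ℕ) : ℤ) hx
    calc |x * (U ℝ (m : ℤ)).eval x + (T ℝ ((m + 1 : ℕ) : ℤ)).eval x|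
        ≤ |x| * |(U ℝ (m : ℤ)).eval x| + |(T ℝ ((m + 1 : ℕ) : ℤ)).eval x| := by
          rw [← abs_mul]; exact abs_add_le _ _
      _ ≤ 1 * ((m : ℝ) + 1) + 1 := by gcongr
      _ = ((m + 1 : ℕ) : ℝ) + 1 := by push_cast; ring

/-- `1 ≤ U_m(x)` for `x ≥ 1`. [folklore] -/
theorem one_le_eval_U (m : ℕ) {x : ℝ} (hx : 1 ≤ x) : 1 ≤ (U ℝ (m : ℤ)).eval x := by
  induction m with
  | zero => simp
  | succ m ih =>
    rw [U_natCast_succ, eval_add, eval_mul, eval_X]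
    have hT := one_le_eval_T_real ((m + 1 : ℕ) : ℤ) hx
    nlinarith

/-- `U_{m+2}(x) - U_m(x) = 2 T_{m+2}(x) ≥ 2` for `x ≥ 1`. [folklore] -/
theorem two_le_eval_U_add_two_sub (m : ℕ) {x : ℝ} (hx : 1 ≤ x) :
    2 ≤ (U ℝ ((m + 2 : ℕ) : ℤ)).eval x - (U ℝ (m : ℤ)).eval x := by
  rw [U_natCast_add_two_T, eval_add, eval_mul]
  have hT := one_le_eval_T_real ((m + 2 : ℕ) : ℤ) hx
  have h2 : (2 : ℝ[X]).eval x = 2 := by simp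
  rw [h2]
  linarith

/-! ## The NBW three-term recursion: generic solutions and the companion sequence `R_m` -/

/-- `Q` solves the NBW recursion with the NBW initial values: `Q₀ = 1`, `Q₁ = X`, `Q₂ = X² - 2d`,
`Q_{m+3} = X·Q_{m+2} - (2d-1)·Q_{m+1}` (the coefficientwise form of
`Σ_m Q_m w^m = (1 - w²)/(1 + (2d-1)w² - wX)`). [folklore; cf. FitznerVanDerHofstad2016NoBLE §1.2.2
eq. (1.12) `B̂_z(k)`] [folklore] -/
def IsNbwPolySeq (d : ℕ) (Q : ℕ → ℝ[X]) : Prop :=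
  Q 0 = 1 ∧ Q 1 = X ∧ Q 2 = X ^ 2 - C (2 * (d : ℝ)) ∧
    ∀ m, Q (m + 3) = X * Q (m + 2) - C (2 * (d : ℝ) - 1) * Q (m + 1)

/-- The companion sequence `R_m(A)`: `R₀ = 1`, `R₁ = A`, `R_{m+2} = A R_{m+1} - (2d-1) R_m`
(`= q^{m/2} U_m(A/2√q)`, `nbwR_eq_chebyshev`). [folklore] -/
def nbwR (d : ℕ) (A : ℝ) : ℕ → ℝ
  | 0 => 1
  | 1 => A
  | (m + 2) => A * nbwR d A (m + 1) - (2 * (d : ℝ) - 1) * nbwR d A m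

/-- `R₀ = 1`. [folklore] -/
@[simp] theorem nbwR_zero (d : ℕ) (A : ℝ) : nbwR d A 0 = 1 := rfl
/-- `R₁ = A`. [folklore] -/
@[simp] theorem nbwR_one (d : ℕ) (A : ℝ) : nbwR d A 1 = A := rfl
/-- The recursion `R_{m+2} = A R_{m+1} - (2d-1) R_m`. [folklore] -/
theorem nbwR_add_two (d : ℕ) (A : ℝ) (m : ℕ) :
    nbwR d A (m + 2) = A * nbwR d A (m + 1) - (2 * (d : ℝ) - 1) * nbwR d A m := rfl

namespace IsNbwPolySeq

variable {d : ℕ} {Q : ℕ → ℝ[X]}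

/-- `Q₀(A) = 1`. [folklore] -/
theorem eval_zero (hQ : IsNbwPolySeq d Q) (A : ℝ) : (Q 0).eval A = 1 := by
  rw [hQ.1, eval_one]

/-- `Q₁(A) = A`. [folklore] -/
theorem eval_one' (hQ : IsNbwPolySeq d Q) (A : ℝ) : (Q 1).eval A = A := by
  rw [hQ.2.1, eval_X]

/-- (L1): `Q_{m+2}(A) = R_{m+2}(A) - R_m(A)`. [folklore] -/
theorem eval_add_two (hQ : IsNbwPolySeq d Q) (A : ℝ) (m : ℕ) :
    (Q (m + 2)).eval A = nbwR d A (m + 2) - nbwR d A m := by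
  -- two-step induction on `m`
  suffices h : ∀ m, (Q (m + 2)).eval A = nbwR d A (m + 2) - nbwR d A m ∧
      (Q (m + 3)).eval A = nbwR d A (m + 3) - nbwR d A (m + 1) from (h m).1
  intro m
  induction m with
  | zero =>
    refine ⟨?_, ?_⟩
    · rw [hQ.2.2.1]; simp [nbwR_add_two]; ring
    · rw [hQ.2.2.2 0, hQ.2.2.1, hQ.2.1]; simp [nbwR_add_two]; ring
  | succ m ih =>
    refine ⟨ih.2, ?_⟩
    have hrec : Q (m + 4) = X * Q (m + 3) - C (2 * (d : ℝ) - 1) * Q (m + 2) := hQ.2.2.2 (m + 1)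
    have e3 : (Q (m + 3)).eval A = nbwR d A (m + 3) - nbwR d A (m + 1) := ih.2
    have e2 : (Q (m + 2)).eval A = nbwR d A (m + 2) - nbwR d A m := ih.1
    have r4 : nbwR d A (m + 4) = A * nbwR d A (m + 3) - (2 * (d : ℝ) - 1) * nbwR d A (m + 2) := rfl
    have r3 : nbwR d A (m + 3) = A * nbwR d A (m + 2) - (2 * (d : ℝ) - 1) * nbwR d A (m + 1) := rfl
    have r2 : nbwR d A (m + 2) = A * nbwR d A (m + 1) - (2 * (d : ℝ) - 1) * nbwR d A m := rfl
    show (Q (m + 4)).eval A = nbwR d A (m + 4) - nbwR d A (m + 2)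
    rw [hrec, eval_sub, eval_mul, eval_mul, eval_X, eval_C, e3, e2, r4, r3, r2]
    ring

/-- Every `Q_m(A)` is either `R_0`, `R_1` or `R_m - R_{m-2}`; uniform evaluation lemma. [folklore] -/
theorem eval_eq (hQ : IsNbwPolySeq d Q) (A : ℝ) (m : ℕ) :
    (Q m).eval A = if m < 2 then nbwR d A m else nbwR d A m - nbwR d A (m - 2) := by
  rcases m with _ | _ | m
  · simp [hQ.eval_zero]
  · simp [hQ.eval_one']
  · rw [if_neg (by omega), hQ.eval_add_two]; rfl

end IsNbwPolySeq

/-! ## `R_m = q^{m/2} U_m(A / 2√q)` and the three bounds -/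

section bounds

variable {d : ℕ}

/-- `2d - 1 > 0` for `d ≥ 1`. [folklore] -/
theorem two_d_sub_one_pos (hd : 1 ≤ d) : (0 : ℝ) < 2 * (d : ℝ) - 1 := by
  have h1 : (1 : ℝ) ≤ (d : ℝ) := Nat.one_le_cast.2 hd
  linarith

/-- `σ = √(2d-1) > 0` for `d ≥ 1`. [folklore] -/
theorem sqrt_two_d_sub_one_pos (hd : 1 ≤ d) : 0 < √(2 * (d : ℝ) - 1) :=
  Real.sqrt_pos.2 (two_d_sub_one_pos hd)

/-- `(√(2d-1))² = 2d-1` for `d ≥ 1`. [folklore] -/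
theorem sq_sqrt_two_d_sub_one (hd : 1 ≤ d) : √(2 * (d : ℝ) - 1) ^ 2 = 2 * (d : ℝ) - 1 :=
  Real.sq_sqrt (two_d_sub_one_pos hd).le

/-- (L1'): `R_m(A) = (√q)^m · U_m(A / 2√q)`. [folklore] -/
theorem nbwR_eq_chebyshev (hd : 1 ≤ d) (A : ℝ) (m : ℕ) :
    nbwR d A m = √(2 * (d : ℝ) - 1) ^ m *
      (U ℝ (m : ℤ)).eval (A / (2 * √(2 * (d : ℝ) - 1))) := by
  set σ := √(2 * (d : ℝ) - 1) with hσ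
  have hσ0 : 0 < σ := sqrt_two_d_sub_one_pos hd
  have hσ2 : σ ^ 2 = 2 * (d : ℝ) - 1 := sq_sqrt_two_d_sub_one hd
  set x := A / (2 * σ) with hx
  have hAx : 2 * x * σ = A := by rw [hx]; field_simp
  suffices h : ∀ m, nbwR d A m = σ ^ m * (U ℝ (m : ℤ)).eval x ∧
      nbwR d A (m + 1) = σ ^ (m + 1) * (U ℝ ((m + 1 : ℕ) : ℤ)).eval x from (h m).1
  intro m
  induction m with
  | zero =>
    refine ⟨by simp, ?_⟩
    simp only [nbwR_one, zero_add, pow_one, Nat.cast_one, U_one, eval_mul, eval_X]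
    rw [show (2 : ℝ[X]).eval x = 2 by simp]
    linarith [hAx]
  | succ m ih =>
    refine ⟨ih.2, ?_⟩
    rw [show m + 1 + 1 = m + 2 from rfl, nbwR_add_two, ih.2, ih.1, U_natCast_add_two, eval_sub,
      eval_mul, eval_mul, eval_X, show (2 : ℝ[X]).eval x = 2 by simp, ← hσ2, ← hAx]
    ring

/-- The closed-form bulk bound `B(m) = (√q)^m (m+1) + (√q)^{m-2} (m-1)` (`B(0) = 1`, `B(1) = 2√q`;
natural-number subtraction in the exponent and in `m - 1`). [folklore] -/
def nbwBulkBound (d m : ℕ) : ℝ :=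
  √(2 * (d : ℝ) - 1) ^ m * ((m : ℝ) + 1) + √(2 * (d : ℝ) - 1) ^ (m - 2) * ((m - 1 : ℕ) : ℝ)

/-- `B(m) ≥ 0`. [folklore] -/
theorem nbwBulkBound_nonneg (d m : ℕ) : 0 ≤ nbwBulkBound d m := by
  unfold nbwBulkBound; positivity

/-- (L2) bulk bound for `R`: `|A| ≤ 2√q → |R_m(A)| ≤ (√q)^m (m+1)`. [folklore] -/
theorem abs_nbwR_le (hd : 1 ≤ d) {A : ℝ} (hA : |A| ≤ 2 * √(2 * (d : ℝ) - 1)) (m : ℕ) :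
    |nbwR d A m| ≤ √(2 * (d : ℝ) - 1) ^ m * ((m : ℝ) + 1) := by
  have hσ0 := sqrt_two_d_sub_one_pos hd
  have h2 : (0 : ℝ) < 2 * √(2 * (d : ℝ) - 1) := mul_pos two_pos hσ0
  have hx : |A / (2 * √(2 * (d : ℝ) - 1))| ≤ 1 := by
    rw [abs_div, abs_of_pos h2, div_le_one h2]; exact hA
  rw [nbwR_eq_chebyshev hd, abs_mul, abs_pow, abs_of_pos hσ0]
  exact mul_le_mul_of_nonneg_left (abs_eval_U_le m hx) (pow_nonneg hσ0.le m)

variable {Q : ℕ → ℝ[X]}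

/-- (L2): `|A| ≤ 2√q → |Q_m(A)| ≤ B(m)`. [folklore] -/
theorem IsNbwPolySeq.abs_eval_le_nbwBulkBound (hQ : IsNbwPolySeq d Q) (hd : 1 ≤ d) {A : ℝ}
    (hA : |A| ≤ 2 * √(2 * (d : ℝ) - 1)) (m : ℕ) :
    |(Q m).eval A| ≤ nbwBulkBound d m := by
  rcases m with _ | _ | m
  · simp [hQ.eval_zero, nbwBulkBound]
  · rw [hQ.eval_one']
    have e : nbwBulkBound d 1 = 2 * √(2 * (d : ℝ) - 1) := by simp [nbwBulkBound]; ring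
    rw [e]; exact hA
  · rw [hQ.eval_add_two, nbwBulkBound, show m + 2 - 2 = m from rfl,
      show (m + 2 - 1 : ℕ) = m + 1 by omega]
    refine (abs_sub _ _).trans ?_
    have h1 := abs_nbwR_le hd hA (m + 2)
    have h2 := abs_nbwR_le hd hA m
    push_cast at h1 h2 ⊢
    linarith

/-- (L3) for `R`: `2√q ≤ A → (√q)^m ≤ R_m(A)` and `R_{m+2}(A) - R_m(A) ≥ 2 (√q)^m`. [folklore] -/
theorem nbwR_add_two_sub_ge (hd : 1 ≤ d) {A : ℝ} (hA : 2 * √(2 * (d : ℝ) - 1) ≤ A) (m : ℕ) :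
    2 * √(2 * (d : ℝ) - 1) ^ m ≤ nbwR d A (m + 2) - nbwR d A m := by
  set σ := √(2 * (d : ℝ) - 1) with hσ
  have hσ0 : 0 < σ := sqrt_two_d_sub_one_pos hd
  have hσ1 : 1 ≤ σ := by
    rw [hσ]
    refine Real.one_le_sqrt.2 ?_
    have h1 : (1 : ℝ) ≤ (d : ℝ) := Nat.one_le_cast.2 hd
    linarith
  have hx : 1 ≤ A / (2 * σ) := by rw [le_div_iff₀ (by positivity)]; linarith
  rw [nbwR_eq_chebyshev hd, nbwR_eq_chebyshev hd]
  have hU := one_le_eval_U (m + 2) hx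
  have hdiff := two_le_eval_U_add_two_sub m hx
  have hpow : σ ^ m ≤ σ ^ (m + 2) := pow_le_pow_right₀ hσ1 (by omega)
  have hσm : 0 < σ ^ m := pow_pos hσ0 m
  -- σ^{m+2} U_{m+2} - σ^m U_m = (σ^{m+2} - σ^m) U_{m+2} + σ^m (U_{m+2} - U_m)
  nlinarith [mul_nonneg (sub_nonneg.2 hpow) (zero_le_one.trans hU),
    mul_le_mul_of_nonneg_left hdiff hσm.le]

/-- (L3): `2√q ≤ A → 0 ≤ Q_m(A)` (indeed `Q_m(A) ≥ 1`, `A`, resp. `2(√q)^{m-2}`). [folklore] -/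
theorem IsNbwPolySeq.eval_nonneg_of_le (hQ : IsNbwPolySeq d Q) (hd : 1 ≤ d) {A : ℝ}
    (hA : 2 * √(2 * (d : ℝ) - 1) ≤ A) (m : ℕ) : 0 ≤ (Q m).eval A := by
  have hσ0 := sqrt_two_d_sub_one_pos hd
  rcases m with _ | _ | m
  · rw [hQ.eval_zero]; exact zero_le_one
  · rw [hQ.eval_one']; linarith
  · rw [hQ.eval_add_two]
    exact le_trans (by positivity) (nbwR_add_two_sub_ge hd hA m)

/-- Parity of `R`: `R_m(-A) = (-1)^m R_m(A)`. [folklore] -/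
theorem nbwR_neg (d : ℕ) (A : ℝ) (m : ℕ) : nbwR d (-A) m = (-1) ^ m * nbwR d A m := by
  suffices h : ∀ m, nbwR d (-A) m = (-1) ^ m * nbwR d A m ∧
      nbwR d (-A) (m + 1) = (-1) ^ (m + 1) * nbwR d A (m + 1) from (h m).1
  intro m
  induction m with
  | zero => simp
  | succ m ih =>
    refine ⟨ih.2, ?_⟩
    rw [show m + 1 + 1 = m + 2 from rfl, nbwR_add_two, nbwR_add_two, ih.1, ih.2]
    ring

/-- (L3') parity: `Q_m(-A) = (-1)^m Q_m(A)`. [folklore] -/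
theorem IsNbwPolySeq.eval_neg (hQ : IsNbwPolySeq d Q) (A : ℝ) (m : ℕ) :
    (Q m).eval (-A) = (-1) ^ m * (Q m).eval A := by
  rcases m with _ | _ | m
  · simp [hQ.eval_zero]
  · simp [hQ.eval_one']
  · rw [hQ.eval_add_two, hQ.eval_add_two, nbwR_neg, nbwR_neg]; ring

/-! ## Products over a composition of even total degree -/

/-- `|Π_i f i| ≤ Π_i B i` when `|f i| ≤ B i` termwise. [folklore] -/
theorem abs_list_prod_le {ι : Type*} (l : List ι) (f B : ι → ℝ)
    (h : ∀ i ∈ l, |f i| ≤ B i) : |(l.map f).prod| ≤ (l.map B).prod := by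
  induction l with
  | nil => simp
  | cons a l ih =>
    simp only [List.map_cons, List.prod_cons, abs_mul]
    have ha := h a (by simp)
    have hl := ih fun i hi => h i (by simp [hi])
    exact mul_le_mul ha hl (abs_nonneg _) ((abs_nonneg _).trans ha)

/-- `Π_i ((-1)^{i}·g i) = (-1)^{Σ i} Π_i g i`. [folklore] -/
theorem list_prod_neg_one_pow_mul (l : List ℕ) (g : ℕ → ℝ) :
    (l.map fun i => (-1 : ℝ) ^ i * g i).prod = (-1) ^ l.sum * (l.map g).prod := by
  induction l with
  | nil => simp
  | cons a l ih => simp only [List.map_cons, List.prod_cons, List.sum_cons, ih, pow_add]; ring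

/-- For a composition `c` with EVEN total degree, `-Π_i B(c_i) ≤ Π_i Q_{c_i}(A)` for every real `A`:
in the bulk by (L2), to the right of it every factor is `≥ 0` (L3), to the left by parity. [folklore] -/
theorem IsNbwPolySeq.neg_prod_bound_le_eval (hQ : IsNbwPolySeq d Q) (hd : 1 ≤ d) (c : List ℕ)
    (hc : Even c.sum) (A : ℝ) :
    -((c.map (nbwBulkBound d)).prod) ≤ ((c.map Q).prod).eval A := by
  have hB0 : 0 ≤ (c.map (nbwBulkBound d)).prod :=
    List.prod_nonneg fun x hx => by
      obtain ⟨i, -, rfl⟩ := List.mem_map.1 hx; exact nbwBulkBound_nonneg d i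
  rw [eval_list_prod, List.map_map]
  by_cases h1 : 2 * √(2 * (d : ℝ) - 1) ≤ A
  · refine le_trans (neg_nonpos.2 hB0) (List.prod_nonneg fun x hx => ?_)
    obtain ⟨i, -, rfl⟩ := List.mem_map.1 hx
    exact hQ.eval_nonneg_of_le hd h1 i
  by_cases h2 : A ≤ -(2 * √(2 * (d : ℝ) - 1))
  · have hA' : 2 * √(2 * (d : ℝ) - 1) ≤ -A := by linarith
    have e : (c.map (Function.comp (eval A) Q)).prod =
        (c.map fun i => (-1 : ℝ) ^ i * (Q i).eval (-A)).prod := by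
      refine congrArg List.prod (List.map_congr_left fun i _ => ?_)
      have := hQ.eval_neg (-A) i
      rw [neg_neg] at this
      exact this
    rw [e, list_prod_neg_one_pow_mul, Even.neg_one_pow hc, one_mul]
    refine le_trans (neg_nonpos.2 hB0) (List.prod_nonneg fun x hx => ?_)
    obtain ⟨i, -, rfl⟩ := List.mem_map.1 hx
    exact hQ.eval_nonneg_of_le hd hA' i
  · have hA : |A| ≤ 2 * √(2 * (d : ℝ) - 1) := abs_le.2 ⟨by linarith, by linarith⟩
    have := abs_list_prod_le c (Function.comp (eval A) Q) (nbwBulkBound d)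
      fun i _ => hQ.abs_eval_le_nbwBulkBound hd hA i
    exact (neg_le_neg this).trans (neg_abs_le _)

/-- The `e₁`-type kernel of an ODD composition: `-(Π_i B(c_i))·(√q/d) ≤ (Π_i Q_{c_i})(A)·A/(2d)`
for every real `A` (even total degree `Σc + 1`; bulk `|A| ≤ 2√q` by (L2), off the bulk both
factors have the same sign). [folklore] -/
theorem IsNbwPolySeq.neg_prod_bound_le_eval_e1 (hQ : IsNbwPolySeq d Q) (hd : 1 ≤ d) (c : List ℕ)
    (hc : Odd c.sum) (A : ℝ) :
    -((c.map (nbwBulkBound d)).prod * (√(2 * (d : ℝ) - 1) / d)) ≤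
      ((c.map Q).prod * C (1 / (2 * (d : ℝ))) * X).eval A := by
  have hσ0 := sqrt_two_d_sub_one_pos hd
  have hd0 : (0 : ℝ) < d := Nat.cast_pos.2 (by omega)
  have hB0 : 0 ≤ (c.map (nbwBulkBound d)).prod :=
    List.prod_nonneg fun x hx => by
      obtain ⟨i, -, rfl⟩ := List.mem_map.1 hx; exact nbwBulkBound_nonneg d i
  have hL0 : 0 ≤ (c.map (nbwBulkBound d)).prod * (√(2 * (d : ℝ) - 1) / d) := by positivity
  rw [eval_mul, eval_mul, eval_C, eval_X, eval_list_prod, List.map_map]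
  by_cases h1 : 2 * √(2 * (d : ℝ) - 1) ≤ A
  · have hP : 0 ≤ (c.map (Function.comp (eval A) Q)).prod :=
      List.prod_nonneg fun x hx => by
        obtain ⟨i, -, rfl⟩ := List.mem_map.1 hx; exact hQ.eval_nonneg_of_le hd h1 i
    have hA0 : 0 ≤ A := by linarith
    exact le_trans (neg_nonpos.2 hL0) (by positivity)
  by_cases h2 : A ≤ -(2 * √(2 * (d : ℝ) - 1))
  · have hA' : 2 * √(2 * (d : ℝ) - 1) ≤ -A := by linarith
    have e : (c.map (Function.comp (eval A) Q)).prod =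
        (c.map fun i => (-1 : ℝ) ^ i * (Q i).eval (-A)).prod := by
      refine congrArg List.prod (List.map_congr_left fun i _ => ?_)
      have := hQ.eval_neg (-A) i
      rw [neg_neg] at this
      exact this
    have hP' : 0 ≤ (c.map fun i => (Q i).eval (-A)).prod :=
      List.prod_nonneg fun x hx => by
        obtain ⟨i, -, rfl⟩ := List.mem_map.1 hx; exact hQ.eval_nonneg_of_le hd hA' i
    rw [e, list_prod_neg_one_pow_mul, Odd.neg_one_pow hc]
    have hA0 : A ≤ 0 := by linarith
    -- (-1 · P') · (1/2d) · A = P' · (1/2d) · (-A) ≥ 0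
    have : 0 ≤ (c.map fun i => (Q i).eval (-A)).prod * (1 / (2 * (d : ℝ))) * (-A) := by
      have : 0 ≤ -A := by linarith
      positivity
    linarith
  · have hA : |A| ≤ 2 * √(2 * (d : ℝ) - 1) := abs_le.2 ⟨by linarith, by linarith⟩
    have hP := abs_list_prod_le c (Function.comp (eval A) Q) (nbwBulkBound d)
      fun i _ => hQ.abs_eval_le_nbwBulkBound hd hA i
    have habs : |(c.map (Function.comp (eval A) Q)).prod * (1 / (2 * (d : ℝ))) * A| ≤
        (c.map (nbwBulkBound d)).prod * (√(2 * (d : ℝ) - 1) / d) := by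
      rw [abs_mul, abs_mul, abs_of_pos (by positivity : (0 : ℝ) < 1 / (2 * (d : ℝ)))]
      calc |(c.map (Function.comp (eval A) Q)).prod| * (1 / (2 * (d : ℝ))) * |A|
          ≤ (c.map (nbwBulkBound d)).prod * (1 / (2 * (d : ℝ))) * (2 * √(2 * (d : ℝ) - 1)) := by
            gcongr
        _ = (c.map (nbwBulkBound d)).prod * (√(2 * (d : ℝ) - 1) / d) := by
            field_simp
    exact (neg_le_neg habs).trans (neg_abs_le _)

/-! ## The certified 'rig' evaluation of `J_n` for even compositions -/

/-- For a composition `c` of even total degree and `d ≥ 2n+1`: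
`J_n(Π_i Q_{c_i}) ≤ Σ_j [Π_i Q_{c_i}]_j (2d)^j I_{n,j}(0) + 2 Π_i B(c_i) · I_{n,0}(0)` — every
quantity on the right is a polynomial coefficient, the closed form `B`, or a table entry
`I_{n,j}(0)`. [folklore] -/
theorem IsNbwPolySeq.nbwJ_prod_le (hQ : IsNbwPolySeq d Q) {n : ℕ} (hdn : 2 * n + 1 ≤ d)
    (c : List ℕ) (hc : Even c.sum) :
    nbwJ d n (c.map Q).prod ≤
      (∑ j ∈ Finset.range ((c.map Q).prod.natDegree + 1),
          ((c.map Q).prod).coeff j * (2 * (d : ℝ)) ^ j * srwI d n j 0)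
        + (2 * (c.map (nbwBulkBound d)).prod) * srwI d n 0 0 := by
  have hd : 1 ≤ d := by omega
  have hB0 : 0 ≤ (c.map (nbwBulkBound d)).prod :=
    List.prod_nonneg fun x hx => by
      obtain ⟨i, -, rfl⟩ := List.mem_map.1 hx; exact nbwBulkBound_nonneg d i
  refine nbwJ_le_coeff_sum_add hdn _ (by positivity) fun t _ => ?_
  have h := hQ.neg_prod_bound_le_eval hd c hc (2 * (d : ℝ) * t)
  linarith

/-- The same for the `e₁`-type kernel of an odd composition:
`J_n((Π_i Q_{c_i})·X/(2d)) ≤ Σ_j [·]_j (2d)^j I_{n,j}(0) + 2 Π_i B(c_i) (√q/d) · I_{n,0}(0)`. [folklore] -/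
theorem IsNbwPolySeq.nbwJ_prod_e1_le (hQ : IsNbwPolySeq d Q) {n : ℕ} (hdn : 2 * n + 1 ≤ d)
    (c : List ℕ) (hc : Odd c.sum) :
    nbwJ d n ((c.map Q).prod * C (1 / (2 * (d : ℝ))) * X) ≤
      (∑ j ∈ Finset.range (((c.map Q).prod * C (1 / (2 * (d : ℝ))) * X).natDegree + 1),
          ((c.map Q).prod * C (1 / (2 * (d : ℝ))) * X).coeff j * (2 * (d : ℝ)) ^ j * srwI d n j 0)
        + (2 * ((c.map (nbwBulkBound d)).prod * (√(2 * (d : ℝ) - 1) / d))) * srwI d n 0 0 := by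
  have hd : 1 ≤ d := by omega
  have hB0 : 0 ≤ (c.map (nbwBulkBound d)).prod :=
    List.prod_nonneg fun x hx => by
      obtain ⟨i, -, rfl⟩ := List.mem_map.1 hx; exact nbwBulkBound_nonneg d i
  have hσ := (sqrt_two_d_sub_one_pos hd).le
  refine nbwJ_le_coeff_sum_add hdn _ (by positivity) fun t _ => ?_
  have h := hQ.neg_prod_bound_le_eval_e1 hd c hc (2 * (d : ℝ) * t)
  linarith

end bounds

end Literature.Probability.FitznerVanDerHofstad2017
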